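import Summits.CriticalPhenomena.PercolationContinuityZ3.Theorems.PercNearOneGluingNoHeavyLowerTailSahiCTCLadderRowTwoTSupply
import HarnessLib

/-!
# `NoHeavyLowerTail` (crux stmt-CriticalPhenomena-4575), P3 lane: the row `#dbl = 2` of `(L_t)`, all `t` — link and double-link supply

Support file (seat `prim-l12-p3`, gen 26; `--supports stmt-CriticalPhenomena-4575`).  Memo g26 §4.16.  With `#(lev m 1) + 2 = n + t`,
`dbl m = {d, d'}`: plain and pinned `(t−1)`-density on the link cubes `κ({d'}, d ∪ T∖Q)` (`rowTwoT_supply_M`: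
`cH(t−1,n)·(n a + (n−t+1) q_{d'}) ≤ n·ΣM_d`, `n·cH(t−1,n−1)·a + (t−1)·cH(t−2,n−1)·q_{d'} ≤ (t−1)·ΣM_d`) and `(t−2)`-density on the
double-link cubes (`rowTwoT_supply_L`: `cH(t−2,n−2)·n(n−1)·a ≤ t(t−1)·ΣL`).  Nothing is asserted about the crux.
-/

namespace Summit.CriticalPhenomena.PercolationContinuityZ3.Theorems.SahiCTCForms

open Finset MvPolynomial SahiCTCGenFun SahiCTCWeightedLYM

variable {α : Type*} [DecidableEq α] [Fintype α]

section RowTwoTSupplyML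
variable {𝒳 𝒵 : Finset (Finset α)}

omit [Fintype α] in
/-- **Supply facts of the link cubes of base `d'`** (plain and pinned `(t−1)`-density; `#(lev m 1) + 2 = n + t`, `n ≥ 2t − 2`). [this work] -/
theorem rowTwoT_supply_M (h𝒳 : IsUpperSet (𝒳 : Set (Finset α))) (h𝒵 : IsUpperSet (𝒵 : Set (Finset α)))
    {t : ℕ} (ht : 2 ≤ t) (hXt : ∀ S ∈ 𝒳, t ≤ #S) (hZt : ∀ S ∈ 𝒵, t ≤ #S) {m : α →₀ ℕ} {d d' : α} (hDe : dbl m = {d, d'}) (hdd' : d ≠ d')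
    {n : ℕ} (hn : #(lev m 1) + 2 = n + t) (hnt : 2 * t ≤ n + 2) :
    ((cH (t - 1) n : ℤ) * (n * #(((lev m 1).powersetCard (t - 2)).filter fun Y => dbl m ∪ Y ∈ 𝒳 ∧ dbl m ∪ Y ∈ 𝒵)
        + (n - t + 1) * #(((lev m 1).powersetCard (t - 1)).filter fun Q => insert d' Q ∈ 𝒳 ∧ insert d' Q ∈ 𝒵))
      ≤ (n : ℤ) * ∑ Q ∈ (lev m 1).powersetCard (t - 1), kapL1 𝒳 𝒵 m d Q) ∧
    ((n : ℤ) * (cH (t - 1) (n - 1) : ℤ) * #(((lev m 1).powersetCard (t - 2)).filter fun Y => dbl m ∪ Y ∈ 𝒳 ∧ dbl m ∪ Y ∈ 𝒵)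
        + ((t : ℤ) - 1) * (cH (t - 2) (n - 1) : ℤ) * #(((lev m 1).powersetCard (t - 1)).filter fun Q => insert d' Q ∈ 𝒳 ∧ insert d' Q ∈ 𝒵)
      ≤ ((t : ℤ) - 1) * ∑ Q ∈ (lev m 1).powersetCard (t - 1), kapL1 𝒳 𝒵 m d Q) := by
  unfold kapL1
  have hDT : Disjoint (dbl m) (lev m 1) := disjoint_dbl_lev_one m
  have hd : d ∈ dbl m := by rw [hDe]; simp
  have hd' : d' ∈ dbl m := by rw [hDe]; simp
  have hdT : d ∉ lev m 1 := fun h => disjoint_left.1 hDT hd h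
  have hd'T : d' ∉ lev m 1 := fun h => disjoint_left.1 hDT hd' h
  have he : (dbl m).erase d = {d'} := by
    rw [hDe]; ext i; simp only [mem_erase, mem_insert, mem_singleton]
    constructor
    · rintro ⟨hne, h | h⟩
      · exact absurd h hne
      · exact h
    · rintro rfl; exact ⟨hdd'.symm, Or.inr rfl⟩
  rw [he]
  set A1 := ((lev m 1).powersetCard (t - 2)).filter fun Y => dbl m ∪ Y ∈ 𝒳 ∧ dbl m ∪ Y ∈ 𝒵 with hA1
  set Qd' := ((lev m 1).powersetCard (t - 1)).filter fun Q => insert d' Q ∈ 𝒳 ∧ insert d' Q ∈ 𝒵 with hQd'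
  have htn : t ≤ n := by omega
  have hlX : ∀ s, ∀ U ∈ tr 𝒳 {d'} s, t - 1 ≤ #U := fun s U hU => by
    have := hXt _ (mem_tr.1 hU).2; have := card_union_le ({d'} : Finset α) U; rw [card_singleton] at this; omega
  have hlZ : ∀ s, ∀ U ∈ tr 𝒵 {d'} s, t - 1 ≤ #U := fun s U hU => by
    have := hZt _ (mem_tr.1 hU).2; have := card_union_le ({d'} : Finset α) U; rw [card_singleton] at this; omega
  have hnQ : ∀ Q ∈ (lev m 1).powersetCard (t - 1), #(insert d (lev m 1 \ Q)) = n - 1 + 1 := fun Q hQ => by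
    rw [card_insert_of_notMem (fun h => hdT (mem_sdiff.1 h).1), card_sdiff_of_subset (mem_powersetCard.1 hQ).1,
      (mem_powersetCard.1 hQ).2]; omega
  have hd'U : ∀ Q, d' ∉ insert d (lev m 1 \ Q) := fun Q h => by
    rcases mem_insert.1 h with h | h
    · exact hdd' h.symm
    · exact hd'T (mem_sdiff.1 h).1
  have hsplit : ∀ Q ∈ (lev m 1).powersetCard (t - 1),
      #(A1.filter fun w => w ⊆ lev m 1 \ Q) + #(Qd'.filter fun w => w ⊆ lev m 1 \ Q)
        ≤ #(csetsT 𝒳 𝒵 {d'} (insert d (lev m 1 \ Q)) (t - 1)) := fun Q hQ => by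
    have h1 := card_filter_le_pinned_linkT (𝒳 := 𝒳) (𝒵 := 𝒵) (s := lev m 1 \ Q) ht hDe hdT
    have h2 := card_filter_le_unpinned_linkT (𝒳 := 𝒳) (𝒵 := 𝒵) (s := lev m 1 \ Q) (t := t) (d' := d') hdT
    have h3 := card_filter_add_card_filter_not (s := csetsT 𝒳 𝒵 {d'} (insert d (lev m 1 \ Q)) (t - 1)) (fun w => d ∈ w)
    calc #(A1.filter fun w => w ⊆ lev m 1 \ Q) + #(Qd'.filter fun w => w ⊆ lev m 1 \ Q)
        ≤ #((csetsT 𝒳 𝒵 {d'} (insert d (lev m 1 \ Q)) (t - 1)).filter fun w => d ∈ w)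
          + #((csetsT 𝒳 𝒵 {d'} (insert d (lev m 1 \ Q)) (t - 1)).filter fun w => ¬ d ∈ w) := add_le_add h1 h2
      _ = _ := h3
  have hA1' : ∀ w ∈ A1, w ⊆ lev m 1 ∧ #w = t - 2 := fun w hw => mem_powersetCard.1 (mem_filter.1 hw).1
  have hQd''' : ∀ w ∈ Qd', w ⊆ lev m 1 ∧ #w = t - 1 := fun w hw => mem_powersetCard.1 (mem_filter.1 hw).1
  have dA : ∑ Q ∈ (lev m 1).powersetCard (t - 1), (#(A1.filter fun w => w ⊆ lev m 1 \ Q) : ℤ) = #A1 * (n.choose (t - 1) : ℕ) := by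
    have := sum_card_filter_subset_sdiff hA1' (t - 1); rw [show #(lev m 1) - (t - 2) = n from by omega] at this; exact_mod_cast this
  have dQ' : ∑ Q ∈ (lev m 1).powersetCard (t - 1), (#(Qd'.filter fun w => w ⊆ lev m 1 \ Q) : ℤ) = #Qd' * ((n - 1).choose (t - 1) : ℕ) := by
    have := sum_card_filter_subset_sdiff hQd''' (t - 1); rw [show #(lev m 1) - (t - 1) = n - 1 from by omega] at this; exact_mod_cast this
  -- binomial identities
  obtain ⟨t1, ht1⟩ : ∃ t1, t = t1 + 1 := ⟨t - 1, by omega⟩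
  have htm1 : t - 1 = t1 := by omega
  obtain ⟨n', hn'⟩ : ∃ n', n = n' + 1 := ⟨n - 1, by omega⟩
  have hnm1 : n - 1 = n' := by omega
  -- j1: n C(n-1,t-1) = (n-t+1) C(n,t-1)
  have j1 : n * (n - 1).choose (t - 1) = (n - (t - 1)) * n.choose (t - 1) := by
    rw [hn', Nat.add_sub_cancel, htm1]
    rcases Nat.eq_zero_or_pos t1 with h0 | hpos
    · rw [h0]; simp
    · obtain ⟨k, hk⟩ : ∃ k, t1 = k + 1 := ⟨t1 - 1, by omega⟩
      rw [hk, Nat.add_one_mul_choose_eq n' (k + 1), Nat.choose_succ_right_eq (n' + 1) (k + 1), mul_comm]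
  -- j2: (t-1) C(n,t-1) = n C(n-1,t-2)
  have j2 : (t - 1) * n.choose (t - 1) = n * (n - 1).choose (t - 2) := by
    obtain ⟨t2, ht2⟩ : ∃ t2, t = t2 + 2 := ⟨t - 2, by omega⟩
    rw [hn', Nat.add_sub_cancel, show t - 1 = t2 + 1 from by omega, show t - 2 = t2 from by omega, Nat.add_one_mul_choose_eq, mul_comm]
  have j1Z : (n : ℤ) * ((n - 1).choose (t - 1) : ℤ) = ((n : ℤ) - t + 1) * (n.choose (t - 1) : ℤ) := by
    have := congrArg (fun k : ℕ => (k : ℤ)) j1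
    push_cast [Nat.cast_sub (show t - 1 ≤ n by omega), Nat.cast_sub (show 1 ≤ t by omega)] at this; linarith
  have j2Z : ((t : ℤ) - 1) * (n.choose (t - 1) : ℤ) = (n : ℤ) * ((n - 1).choose (t - 2) : ℤ) := by
    have := congrArg (fun k : ℕ => (k : ℤ)) j2; push_cast [Nat.cast_sub (show 1 ≤ t by omega)] at this; linarith
  have hC1 : (0 : ℤ) < (n.choose (t - 1) : ℤ) := by exact_mod_cast Nat.choose_pos (by omega)
  have hC2 : (0 : ℤ) < ((n - 1).choose (t - 1) : ℤ) := by exact_mod_cast Nat.choose_pos (by omega)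
  have hC3 : (0 : ℤ) < ((n - 1).choose (t - 2) : ℤ) := by exact_mod_cast Nat.choose_pos (by omega)
  refine ⟨?_, ?_⟩
  · -- plain (t-1)-density
    have hP : ∀ Q ∈ (lev m 1).powersetCard (t - 1),
        (cH (t - 1) n : ℤ) * ((#(A1.filter fun w => w ⊆ lev m 1 \ Q) : ℤ) + #(Qd'.filter fun w => w ⊆ lev m 1 \ Q))
          ≤ (n.choose (t - 1) : ℤ) * kap 𝒳 𝒵 {d'} (insert d (lev m 1 \ Q)) := fun Q hQ => by
      have h := densityT_le_kap h𝒳 h𝒵 (t - 1) n {d'} (insert d (lev m 1 \ Q)) (disjoint_singleton_left.2 (hd'U Q))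
        (by rw [hnQ Q hQ]; omega) (hlX _) (hlZ _)
      have h2 := mul_le_mul_of_nonneg_left (show ((#(A1.filter fun w => w ⊆ lev m 1 \ Q) : ℤ) + #(Qd'.filter fun w => w ⊆ lev m 1 \ Q))
          ≤ #(csetsT 𝒳 𝒵 {d'} (insert d (lev m 1 \ Q)) (t - 1)) by exact_mod_cast hsplit Q hQ)
        (show (0 : ℤ) ≤ cH (t - 1) n from Nat.cast_nonneg _)
      linarith
    have sP := sum_le_sum hP
    rw [← mul_sum, ← mul_sum, sum_add_distrib, dA, dQ'] at sP
    generalize hM : ∑ Q ∈ (lev m 1).powersetCard (t - 1), kap 𝒳 𝒵 {d'} (insert d (lev m 1 \ Q)) = M at sP ⊢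
    generalize ha : (#A1 : ℤ) = a at sP ⊢
    generalize hq : (#Qd' : ℤ) = q at sP ⊢
    generalize hR1 : (cH (t - 1) n : ℤ) = R1 at sP ⊢
    generalize hB1 : (n.choose (t - 1) : ℤ) = B1 at sP j1Z hC1 ⊢
    generalize hB2 : ((n - 1).choose (t - 1) : ℤ) = B2 at sP j1Z ⊢
    refine le_of_mul_le_mul_left ?_ hC1
    have key : B1 * (R1 * ((n : ℤ) * a + (n - t + 1) * q)) = (n : ℤ) * (R1 * (a * B1 + q * B2)) := by
      linear_combination (-(R1 * q)) * j1Z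
    rw [key]
    have fin := mul_le_mul_of_nonneg_left sP (show (0 : ℤ) ≤ n from Nat.cast_nonneg _)
    linarith only [fin]
  · -- pinned (t-1)-density at d
    have hP : ∀ Q ∈ (lev m 1).powersetCard (t - 1),
        ((cH (t - 1) (n - 1) * (n - 1).choose (t - 1) : ℕ) : ℤ) * #(A1.filter fun w => w ⊆ lev m 1 \ Q)
          + ((cH (t - 2) (n - 1) * (n - 1).choose (t - 2) : ℕ) : ℤ) * #(Qd'.filter fun w => w ⊆ lev m 1 \ Q)
          ≤ (((n - 1).choose (t - 2) * (n - 1).choose (t - 1) : ℕ) : ℤ) * kap 𝒳 𝒵 {d'} (insert d (lev m 1 \ Q)) := fun Q hQ => by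
      have h := pinnedT_le_kap h𝒳 h𝒵 (t - 2) (n - 1) {d'} (insert d (lev m 1 \ Q)) d (disjoint_singleton_left.2 (hd'U Q)) (hnQ Q hQ)
        (mem_insert_self d _) (by omega) (by rw [show t - 2 + 1 = t - 1 from by omega]; exact hlX _)
        (by rw [show t - 2 + 1 = t - 1 from by omega]; exact hlZ _)
      rw [show t - 2 + 1 = t - 1 from by omega] at h
      have h1 := card_filter_le_pinned_linkT (𝒳 := 𝒳) (𝒵 := 𝒵) (s := lev m 1 \ Q) ht hDe hdT
      have h2 := card_filter_le_unpinned_linkT (𝒳 := 𝒳) (𝒵 := 𝒵) (s := lev m 1 \ Q) (t := t) (d' := d') hdT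
      have m1 := mul_le_mul_of_nonneg_left (show (#(A1.filter fun w => w ⊆ lev m 1 \ Q) : ℤ)
          ≤ #((csetsT 𝒳 𝒵 {d'} (insert d (lev m 1 \ Q)) (t - 1)).filter fun w => d ∈ w) by exact_mod_cast h1)
        (show (0 : ℤ) ≤ ((cH (t - 1) (n - 1) * (n - 1).choose (t - 1) : ℕ) : ℤ) from Nat.cast_nonneg _)
      have m2 := mul_le_mul_of_nonneg_left (show (#(Qd'.filter fun w => w ⊆ lev m 1 \ Q) : ℤ)
          ≤ #((csetsT 𝒳 𝒵 {d'} (insert d (lev m 1 \ Q)) (t - 1)).filter fun w => d ∉ w) by exact_mod_cast h2)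
        (show (0 : ℤ) ≤ ((cH (t - 2) (n - 1) * (n - 1).choose (t - 2) : ℕ) : ℤ) from Nat.cast_nonneg _)
      linarith
    have sP := sum_le_sum hP
    rw [sum_add_distrib, ← mul_sum, ← mul_sum, ← mul_sum, dA, dQ'] at sP
    push_cast at sP
    generalize hM : ∑ Q ∈ (lev m 1).powersetCard (t - 1), kap 𝒳 𝒵 {d'} (insert d (lev m 1 \ Q)) = M at sP ⊢
    generalize ha : (#A1 : ℤ) = a at sP ⊢
    generalize hq : (#Qd' : ℤ) = q at sP ⊢
    generalize hP1 : (cH (t - 1) (n - 1) : ℤ) = P1 at sP ⊢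
    generalize hQ1 : (cH (t - 2) (n - 1) : ℤ) = Q1 at sP ⊢
    generalize hB1 : (n.choose (t - 1) : ℤ) = B1 at sP j2Z ⊢
    generalize hB2 : ((n - 1).choose (t - 1) : ℤ) = B2 at sP hC2 ⊢
    generalize hB3 : ((n - 1).choose (t - 2) : ℤ) = B3 at sP j2Z hC3 ⊢
    have hpos : 0 < B3 * B2 := mul_pos hC3 hC2
    refine le_of_mul_le_mul_left ?_ hpos
    have key : B3 * B2 * ((n : ℤ) * P1 * a + (t - 1) * Q1 * q) = ((t : ℤ) - 1) * (P1 * B2 * (a * B1) + Q1 * B3 * (q * B2)) := by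
      linear_combination (-(P1 * a * B2)) * j2Z
    have ht1 : (0 : ℤ) ≤ (t : ℤ) - 1 := by linarith
    have fin := mul_le_mul_of_nonneg_left sP ht1
    rw [key]
    linarith only [fin]

omit [Fintype α] in
/-- **Supply fact of the double-link cubes** (`(t−2)`-density; `#(lev m 1) + 2 = n + t`). [this work] -/
theorem rowTwoT_supply_L (h𝒳 : IsUpperSet (𝒳 : Set (Finset α))) (h𝒵 : IsUpperSet (𝒵 : Set (Finset α)))
    {t : ℕ} (ht : 2 ≤ t) (hXt : ∀ S ∈ 𝒳, t ≤ #S) (hZt : ∀ S ∈ 𝒵, t ≤ #S) {m : α →₀ ℕ} (hD : #(dbl m) = 2)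
    {n : ℕ} (hn : #(lev m 1) + 2 = n + t) (hnt : t ≤ n) :
    (cH (t - 2) (n - 2) : ℤ) * (n * (n - 1)) * #(((lev m 1).powersetCard (t - 2)).filter fun Y => dbl m ∪ Y ∈ 𝒳 ∧ dbl m ∪ Y ∈ 𝒵)
      ≤ (t : ℤ) * (t - 1) * ∑ E ∈ (lev m 1).powersetCard t, kap 𝒳 𝒵 (dbl m) (lev m 1 \ E) := by
  have hDT : Disjoint (dbl m) (lev m 1) := disjoint_dbl_lev_one m
  set A1 := ((lev m 1).powersetCard (t - 2)).filter fun Y => dbl m ∪ Y ∈ 𝒳 ∧ dbl m ∪ Y ∈ 𝒵 with hA1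
  have hl1X : ∀ s, ∀ U ∈ tr 𝒳 (dbl m) s, t - 2 ≤ #U := fun s U hU => by
    have := hXt _ (mem_tr.1 hU).2; have := card_union_le (dbl m) U; omega
  have hl1Z : ∀ s, ∀ U ∈ tr 𝒵 (dbl m) s, t - 2 ≤ #U := fun s U hU => by
    have := hZt _ (mem_tr.1 hU).2; have := card_union_le (dbl m) U; omega
  have hcs : ∀ s, s ⊆ lev m 1 → csetsT 𝒳 𝒵 (dbl m) s (t - 2) = A1.filter fun w => w ⊆ s := fun s hs => by
    ext w; simp only [csetsT, A1, mem_filter, mem_powersetCard]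
    constructor
    · rintro ⟨⟨hws, hw1⟩, hX, hZ⟩; exact ⟨⟨⟨hws.trans hs, hw1⟩, hX, hZ⟩, hws⟩
    · rintro ⟨⟨⟨_, hw1⟩, hX, hZ⟩, hws⟩; exact ⟨⟨hws, hw1⟩, hX, hZ⟩
  have hnE : ∀ E ∈ (lev m 1).powersetCard t, #(lev m 1 \ E) = n - 2 := fun E hE => by
    rw [card_sdiff_of_subset (mem_powersetCard.1 hE).1, (mem_powersetCard.1 hE).2]; omega
  have hA1' : ∀ w ∈ A1, w ⊆ lev m 1 ∧ #w = t - 2 := fun w hw => mem_powersetCard.1 (mem_filter.1 hw).1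
  have hL : ∀ E ∈ (lev m 1).powersetCard t,
      (cH (t - 2) (n - 2) : ℤ) * #(A1.filter fun w => w ⊆ lev m 1 \ E) ≤ ((n - 2).choose (t - 2) : ℤ) * kap 𝒳 𝒵 (dbl m) (lev m 1 \ E) :=
      fun E hE => by
    have h := densityT_le_kap h𝒳 h𝒵 (t - 2) (n - 2) (dbl m) (lev m 1 \ E) (hDT.mono_right sdiff_subset) (hnE E hE) (hl1X _) (hl1Z _)
    rw [hcs _ sdiff_subset] at h; exact h
  have sL := sum_le_sum hL
  rw [← mul_sum, ← mul_sum] at sL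
  have dA : ∑ E ∈ (lev m 1).powersetCard t, (#(A1.filter fun w => w ⊆ lev m 1 \ E) : ℤ) = #A1 * (n.choose t : ℕ) := by
    have := sum_card_filter_subset_sdiff hA1' t; rw [show #(lev m 1) - (t - 2) = n from by omega] at this; exact_mod_cast this
  rw [dA] at sL
  -- identity: C(n,t) t (t-1) = n (n-1) C(n-2,t-2)
  obtain ⟨t2, ht2⟩ : ∃ t2, t = t2 + 2 := ⟨t - 2, by omega⟩
  obtain ⟨n2, hn2⟩ : ∃ n2, n = n2 + 2 := ⟨n - 2, by omega⟩
  have j : n.choose t * (t * (t - 1)) = n * (n - 1) * (n - 2).choose (t - 2) := by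
    rw [ht2, hn2, show t2 + 2 - 1 = t2 + 1 from by omega, show n2 + 2 - 1 = n2 + 1 from by omega, Nat.add_sub_cancel, Nat.add_sub_cancel]
    have h1 := Nat.add_one_mul_choose_eq (n2 + 1) (t2 + 1)   -- (n2+2) C(n2+1,t2+1) = C(n2+2,t2+2)(t2+2)
    have h2 := Nat.add_one_mul_choose_eq n2 t2               -- (n2+1) C(n2,t2) = C(n2+1,t2+1)(t2+1)
    calc (n2 + 2).choose (t2 + 2) * ((t2 + 2) * (t2 + 1)) = ((n2 + 1 + 1).choose (t2 + 1 + 1) * (t2 + 1 + 1)) * (t2 + 1) := by ring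
      _ = ((n2 + 1 + 1) * (n2 + 1).choose (t2 + 1)) * (t2 + 1) := by rw [← h1]
      _ = (n2 + 2) * ((n2 + 1).choose (t2 + 1) * (t2 + 1)) := by ring
      _ = (n2 + 2) * ((n2 + 1) * n2.choose t2) := by rw [← h2]
      _ = (n2 + 2) * (n2 + 2 - 1) * n2.choose t2 := by rw [show n2 + 2 - 1 = n2 + 1 from by omega]; ring
  have jZ : (n.choose t : ℤ) * ((t : ℤ) * (t - 1)) = (n : ℤ) * (n - 1) * ((n - 2).choose (t - 2) : ℤ) := by
    have := congrArg (fun k : ℕ => (k : ℤ)) j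
    push_cast [Nat.cast_sub (show 1 ≤ t by omega), Nat.cast_sub (show 1 ≤ n by omega)] at this; linarith
  have hC : (0 : ℤ) < ((n - 2).choose (t - 2) : ℤ) := by exact_mod_cast Nat.choose_pos (by omega)
  generalize hL' : ∑ E ∈ (lev m 1).powersetCard t, kap 𝒳 𝒵 (dbl m) (lev m 1 \ E) = L at sL ⊢
  generalize ha : (#A1 : ℤ) = a at sL ⊢
  generalize hR0 : (cH (t - 2) (n - 2) : ℤ) = R0 at sL ⊢
  generalize hB : ((n - 2).choose (t - 2) : ℤ) = B at sL jZ hC ⊢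
  generalize hB' : (n.choose t : ℤ) = B' at sL jZ ⊢
  refine le_of_mul_le_mul_left ?_ hC
  have key : B * (R0 * ((n : ℤ) * (n - 1)) * a) = R0 * (a * B') * ((t : ℤ) * (t - 1)) := by
    linear_combination (-(R0 * a)) * jZ
  rw [key]
  have fin := mul_le_mul_of_nonneg_left sL (show (0 : ℤ) ≤ (t : ℤ) * (t - 1) by
    have : (0 : ℤ) ≤ (t : ℤ) - 1 := by linarith
    positivity)
  linarith only [fin]

end RowTwoTSupplyML

end Summit.CriticalPhenomena.PercolationContinuityZ3.Theorems.SahiCTCForms
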